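import Literature.Geometry.Lorentzian.KerrSchildMultiplierCurrent
import Literature.Geometry.Lorentzian.MinkowskiRadialMultiplier
import Summits.FinalStateConjecture.FinalStateConjecture.Theorems.ClusterCompletenessAdiabaticMultiKerrILEDHomothetyFlux
import Summits.FinalStateConjecture.FinalStateConjecture.Theorems.ClusterCompletenessAdiabaticMultiKerrILEDFarPointwise
import Summits.FinalStateConjecture.FinalStateConjecture.Theorems.ClusterCompletenessAdiabaticMultiKerrILEDMilneVelocity

/-! # Route ClusterCompleteness — crux `AdiabaticMultiKerrILED`: two-sided bounds of the Milne-velocity energy density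

Helper file for the crux `stmt-FinalStateConjecture-14310` (line `Sketch`, lead c6 wave 2, card
milne-hubble-current): on Minkowski space (`η = diag(−1, 1, 1, 1)`, `Minkowski.bilin`) let
`τ(y) = √(−η(y − x₀, y − x₀))` be the Milne time about the event `x₀` and `V = (y − x₀)/τ` the
Milne 4-velocity. With `T = x⁰ − x₀⁰`, `d⃗ = x⃗ − x⃗₀`, `p_μ = ∂_μ w(x)`:

* `milneFlux_coercive` — `J^V = τ⁻¹ J^S` for the homothety `S = y − x₀`
  (`KerrSchild.multiplierCurrent_smul`), so the cone coercivity of `−(J^S)⁰`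
  (`homothetyFlux_coercive`) gives `½ ((T − |d⃗|)/τ) ∑_μ p_μ² ≤ −(J^V)⁰`;
* `milneTime_sq_bounds` — on the truncated cone `|d⃗| ≤ v T`:
  `(1 − v²) T² ≤ τ² = T² − |d⃗|² ≤ T²`;
* `abs_milneCurrent_le` — `|(J^V)^μ| ≤ (3/2) · (1 + 3v)/√(1 − v²) · ∑_μ p_μ²` there, from
  `|(J^X)^μ| ≤ (3/2) (∑_α |X^α|) ∑ p²` (`abs_multiplierCurrent_eta_le`) and
  `∑_α |V^α| = (T + ∑ᵢ |dᵢ|)/τ ≤ (1 + 3v) T/(√(1 − v²) T)`.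
[folklore] -/

noncomputable section

-- the doubled `FinalStateConjecture.FinalStateConjecture` path component trips dupNamespace
set_option linter.dupNamespace false

open scoped BigOperators
open Literature.Geometry.Lorentzian

namespace Summit.FinalStateConjecture.FinalStateConjecture.Theorems

/-! ### Coordinates of the interval to `x₀` -/

/-- `|x⃗ − x⃗₀|² = ∑ᵢ (xⁱ − x₀ⁱ)²` in coordinates. [folklore] -/
private theorem milneFlux_spatial_sq (x₀ x : E4) :
    ‖E4.spatial x - E4.spatial x₀‖ ^ 2 =
      (x 1 - x₀ 1) ^ 2 + (x 2 - x₀ 2) ^ 2 + (x 3 - x₀ 3) ^ 2 := by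
  rw [← map_sub]
  have h := E4.spatialNorm_sq (x - x₀)
  simpa [E4.spatialNorm] using h

/-- `τ² = −η(x − x₀, x − x₀) = (x⁰ − x₀⁰)² − |x⃗ − x⃗₀|²`. [folklore] -/
private theorem milneFlux_interval_eq (x₀ x : E4) :
    -(Minkowski.bilin (x - x₀) (x - x₀)) =
      (x 0 - x₀ 0) ^ 2 - ‖E4.spatial x - E4.spatial x₀‖ ^ 2 := by
  rw [milne_interval_eq, milneFlux_spatial_sq]
  ring

/-- Each spatial coordinate difference is bounded by the spatial distance,
`|xⁱ − x₀ⁱ| ≤ |x⃗ − x⃗₀|`. [folklore] -/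
private theorem milneFlux_abs_sub_le (x₀ x : E4) (i : Fin 3) :
    |x i.succ - x₀ i.succ| ≤ ‖E4.spatial x - E4.spatial x₀‖ := by
  have h := PiLp.norm_apply_le (E4.spatial x - E4.spatial x₀) i
  rwa [PiLp.sub_apply, E4.spatial_apply, E4.spatial_apply, Real.norm_eq_abs] at h

/-- `∑_α |x^α − x₀^α| ≤ (x⁰ − x₀⁰) + 3 |x⃗ − x⃗₀|` in the future of `x₀` (`x⁰ > x₀⁰`), by the
crude bound `|xⁱ − x₀ⁱ| ≤ |x⃗ − x⃗₀|` on each of the three spatial components. [folklore] -/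
private theorem milneFlux_sum_abs_sub_le (x₀ x : E4) (hT : 0 < x 0 - x₀ 0) :
    ∑ α, |x α - x₀ α| ≤ (x 0 - x₀ 0) + 3 * ‖E4.spatial x - E4.spatial x₀‖ := by
  have h1 := milneFlux_abs_sub_le x₀ x 0
  have h2 := milneFlux_abs_sub_le x₀ x 1
  have h3 := milneFlux_abs_sub_le x₀ x 2
  simp only [Fin.succ_zero_eq_one, Fin.succ_one_eq_two, Fin.reduceSucc] at h1 h2 h3
  rw [Fin.sum_univ_four, abs_of_pos hT]
  linarith

/-! ### The three bounds -/

/-- **Cone coercivity of the Milne-velocity energy density.** For `η = diag(−1,1,1,1)` and the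
Milne 4-velocity `V^α(y) = (y^α − x₀^α)/τ(y)`, `τ = √(−η(y − x₀, y − x₀))`, inside the light cone
of `x₀` (`τ(x)² > 0`): `½ ((x⁰ − x₀⁰) − |x⃗ − x⃗₀|)/τ · ∑_μ (∂_μw)² ≤ −(J^V)⁰(x)`
(`J^V = τ⁻¹ J^S` pointwise for the homothety `S = y − x₀`, and `homothetyFlux_coercive`).
[folklore] -/
theorem milneFlux_coercive : ∀ (x₀ : E4) (w : E4 → ℝ) (x : E4) (hx : 0 < -(Minkowski.bilin (x - x₀) (x - x₀))), 2⁻¹ * (((x 0 - x₀ 0) - ‖E4.spatial x - E4.spatial x₀‖) / Real.sqrt (-(Minkowski.bilin (x - x₀) (x - x₀)))) * ∑ μ, fderiv ℝ w x (E4.basisVector μ) ^ 2 ≤ -KerrSchild.multiplierCurrent (fun _ ↦ Kerr.etaComp) (fun y α ↦ (y α - x₀ α) / Real.sqrt (-(Minkowski.bilin (y - x₀) (y - x₀)))) w x 0 := by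
  intro x₀ w x hx
  -- `V = τ⁻¹ • S`
  have hX : (fun (y : E4) (α : Fin 4) ↦ (y α - x₀ α) / Real.sqrt (-(Minkowski.bilin (y - x₀) (y - x₀)))) =
      fun y α ↦ (Real.sqrt (-(Minkowski.bilin (y - x₀) (y - x₀))))⁻¹ * (y α - x₀ α) := by
    funext y α
    rw [div_eq_inv_mul]
  rw [hX, KerrSchild.multiplierCurrent_smul]
  have h := homothetyFlux_coercive x₀ w x
  have hτ : 0 < Real.sqrt (-(Minkowski.bilin (x - x₀) (x - x₀))) := Real.sqrt_pos.mpr hx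
  calc 2⁻¹ * (((x 0 - x₀ 0) - ‖E4.spatial x - E4.spatial x₀‖) /
          Real.sqrt (-(Minkowski.bilin (x - x₀) (x - x₀)))) * ∑ μ, fderiv ℝ w x (E4.basisVector μ) ^ 2
      = (Real.sqrt (-(Minkowski.bilin (x - x₀) (x - x₀))))⁻¹ *
          (2⁻¹ * ((x 0 - x₀ 0) - ‖E4.spatial x - E4.spatial x₀‖) *
            ∑ μ, fderiv ℝ w x (E4.basisVector μ) ^ 2) := by
        rw [div_eq_inv_mul]; ring
    _ ≤ (Real.sqrt (-(Minkowski.bilin (x - x₀) (x - x₀))))⁻¹ *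
          -KerrSchild.multiplierCurrent (fun _ ↦ Kerr.etaComp) (fun y α ↦ y α - x₀ α) w x 0 :=
        mul_le_mul_of_nonneg_left h (inv_nonneg.mpr hτ.le)
    _ = -((Real.sqrt (-(Minkowski.bilin (x - x₀) (x - x₀))))⁻¹ *
          KerrSchild.multiplierCurrent (fun _ ↦ Kerr.etaComp) (fun y α ↦ y α - x₀ α) w x 0) := by
        ring

/-- **The Milne time on lab slices of the truncated cone.** If `|x⃗ − x⃗₀| ≤ v (x⁰ − x₀⁰)` then
`(1 − v²)(x⁰ − x₀⁰)² ≤ −η(x − x₀, x − x₀) ≤ (x⁰ − x₀⁰)²`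
(`−η(x − x₀, x − x₀) = (x⁰ − x₀⁰)² − |x⃗ − x⃗₀|²` and `0 ≤ |x⃗ − x⃗₀|² ≤ v² (x⁰ − x₀⁰)²`).
[folklore] -/
theorem milneTime_sq_bounds : ∀ (x₀ x : E4) (v : ℝ) (hcone : ‖E4.spatial x - E4.spatial x₀‖ ≤ v * (x 0 - x₀ 0)), (1 - v ^ 2) * (x 0 - x₀ 0) ^ 2 ≤ -(Minkowski.bilin (x - x₀) (x - x₀)) ∧ -(Minkowski.bilin (x - x₀) (x - x₀)) ≤ (x 0 - x₀ 0) ^ 2 := by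
  intro x₀ x v hcone
  have hD0 : 0 ≤ ‖E4.spatial x - E4.spatial x₀‖ := norm_nonneg _
  have hsq : ‖E4.spatial x - E4.spatial x₀‖ ^ 2 ≤ (v * (x 0 - x₀ 0)) ^ 2 :=
    pow_le_pow_left₀ hD0 hcone 2
  rw [milneFlux_interval_eq]
  constructor
  · nlinarith [hsq]
  · nlinarith [sq_nonneg ‖E4.spatial x - E4.spatial x₀‖]

/-- **Upper bound of the Milne-velocity current on lab slices of the truncated cone.** For
`η = diag(−1,1,1,1)`, `V^α(y) = (y^α − x₀^α)/τ(y)`, on `{|x⃗ − x⃗₀| ≤ v (x⁰ − x₀⁰), x⁰ > x₀⁰}` with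
`v < 1`: `|(J^V)^μ(x)| ≤ (3/2) · (1 + 3v)/√(1 − v²) · ∑_κ (∂_κ w)²`
(`|(J^V)^μ| ≤ (3/2) (∑_α |V^α|) ∑ p²` and `∑_α |V^α| ≤ ((x⁰ − x₀⁰) + 3|x⃗ − x⃗₀|)/τ ≤
(1 + 3v)(x⁰ − x₀⁰)/τ ≤ (1 + 3v)/√(1 − v²)` as `τ ≥ √(1 − v²) (x⁰ − x₀⁰)`). [folklore] -/
theorem abs_milneCurrent_le : ∀ (x₀ : E4) (w : E4 → ℝ) (x : E4) (v : ℝ) (hv1 : v < 1) (hcone : ‖E4.spatial x - E4.spatial x₀‖ ≤ v * (x 0 - x₀ 0)) (hT : 0 < x 0 - x₀ 0) (μ : Fin 4), |KerrSchild.multiplierCurrent (fun _ ↦ Kerr.etaComp) (fun y α ↦ (y α - x₀ α) / Real.sqrt (-(Minkowski.bilin (y - x₀) (y - x₀)))) w x μ| ≤ 3 / 2 * ((1 + 3 * v) / Real.sqrt (1 - v ^ 2)) * ∑ κ, fderiv ℝ w x (E4.basisVector κ) ^ 2 := by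
  intro x₀ w x v hv1 hcone hT μ
  have hD0 : 0 ≤ ‖E4.spatial x - E4.spatial x₀‖ := norm_nonneg _
  have hv0 : 0 ≤ v := by nlinarith
  have h1v : 0 < 1 - v ^ 2 := by nlinarith
  obtain ⟨hlow, -⟩ := milneTime_sq_bounds x₀ x v hcone
  have hu : 0 < -(Minkowski.bilin (x - x₀) (x - x₀)) := lt_of_lt_of_le (by positivity) hlow
  have hτ : 0 < Real.sqrt (-(Minkowski.bilin (x - x₀) (x - x₀))) := Real.sqrt_pos.mpr hu
  have hs : 0 < Real.sqrt (1 - v ^ 2) := Real.sqrt_pos.mpr h1v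
  -- `√(1 − v²) T ≤ τ`
  have hsT : Real.sqrt (1 - v ^ 2) * (x 0 - x₀ 0) ≤ Real.sqrt (-(Minkowski.bilin (x - x₀) (x - x₀))) := by
    refine Real.le_sqrt_of_sq_le ?_
    rw [mul_pow, Real.sq_sqrt h1v.le]
    exact hlow
  -- `∑_α |V^α| ≤ (1 + 3v)/√(1 − v²)`
  have hsum : ∑ α, |(x α - x₀ α) / Real.sqrt (-(Minkowski.bilin (x - x₀) (x - x₀)))| ≤
      (1 + 3 * v) / Real.sqrt (1 - v ^ 2) := by
    have h1 : ∑ α, |(x α - x₀ α) / Real.sqrt (-(Minkowski.bilin (x - x₀) (x - x₀)))| =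
        (∑ α, |x α - x₀ α|) / Real.sqrt (-(Minkowski.bilin (x - x₀) (x - x₀))) := by
      rw [Finset.sum_div]
      refine Finset.sum_congr rfl fun α _ ↦ ?_
      rw [abs_div, abs_of_pos hτ]
    have h2 : ∑ α, |x α - x₀ α| ≤ (1 + 3 * v) * (x 0 - x₀ 0) := by
      have h := milneFlux_sum_abs_sub_le x₀ x hT
      nlinarith [hcone]
    rw [h1, div_le_div_iff₀ hτ hs]
    calc (∑ α, |x α - x₀ α|) * Real.sqrt (1 - v ^ 2)
        ≤ (1 + 3 * v) * (x 0 - x₀ 0) * Real.sqrt (1 - v ^ 2) :=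
          mul_le_mul_of_nonneg_right h2 hs.le
      _ = (1 + 3 * v) * (Real.sqrt (1 - v ^ 2) * (x 0 - x₀ 0)) := by ring
      _ ≤ (1 + 3 * v) * Real.sqrt (-(Minkowski.bilin (x - x₀) (x - x₀))) :=
          mul_le_mul_of_nonneg_left hsT (by linarith)
  have hS : 0 ≤ ∑ κ, fderiv ℝ w x (E4.basisVector κ) ^ 2 := Finset.sum_nonneg fun _ _ ↦ sq_nonneg _
  have key := Summit.FinalStateConjecture.FinalStateConjecture.Cruxes.AdiabaticMultiKerrILED.Sketch.abs_multiplierCurrent_eta_le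
    (fun y α ↦ (y α - x₀ α) / Real.sqrt (-(Minkowski.bilin (y - x₀) (y - x₀)))) w x μ
  refine key.trans ?_
  exact mul_le_mul_of_nonneg_right (mul_le_mul_of_nonneg_left hsum (by norm_num)) hS

end Summit.FinalStateConjecture.FinalStateConjecture.Theorems
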